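import Literature.Geometry.Symplectic.PlusOneSpherePairProofs
import Literature.Topology.FourManifolds.ProjectiveLineRotationField

/-!
# Möbius transformations act transitively on the Riemann sphere
(registered helper `helper_moebiusTransitive` of the stub `stub_normalWitnessTransfer`, line
`cross-cap-laurent`, crux `GromovRecognitionRelEnd`, item stmt-SmoothPoincare4-11009)

Claim: for every point `θ` of the tree's `ℂℙ¹ = ComplexProjectiveSpace 1` there is an invertible
complex-linear `A` of `ℂ²` whose projective transformation
`PlusOneSpherePair.projectiveMap A : [v] ↦ [A v]` carries the point at infinity
`CodimTwoData.linePt 1 0 = [0 : 1]` to `θ`.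

Proof (P. Griffiths, J. Harris, *Principles of Algebraic Geometry* (1978), Ch. 0 §2: `PGL₂(ℂ)`
acts transitively on `ℙ¹`, because `GL₂(ℂ)` acts transitively on `ℂ² ∖ {0}`): by definition of
the affine chart, `linePt 1 0 = mk v∞` for an explicit nonzero homogeneous vector `v∞`
(`affineChart_symm_apply`), and `θ = mk w` for a nonzero `w` (`ComplexProjectiveSpace.ind`).
Extend `v∞` and `w` to bases `(v∞, v')`, `(w, w')` of `ℂ²`
(`exists_linearIndependent_pair_of_one_lt_finrank`, `basisOfLinearIndependentOfCardEqFinrank`)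
and let `A` be the linear equivalence carrying the first basis to the second
(`Module.Basis.equiv`); then `projectiveMap A (mk v∞) = mk (A v∞) = mk w = θ`
(`projectiveMap_mk`).
No new definitions.
-/

open Function Literature.Topology.FourManifolds
  Literature.Topology.FourManifolds.ComplexProjectiveSpace Literature.Geometry.Symplectic

-- the prescribed namespace `Summit.<P>.<Sub>.…` duplicates `SmoothPoincare4` (P = Sub)
set_option linter.dupNamespace false

namespace Summit.SmoothPoincare4.SmoothPoincare4.Theorems.GromovRecognitionRelEnd.CrossCapLaurent

namespace HelperMoebiusTransitive

/-- `GL₂(ℂ)` acts transitively on the nonzero vectors of `ℂ²`: any nonzero `v` is carried to any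
nonzero `w` by a linear automorphism (extend both to bases and map one basis to the other).
[folklore] -/
theorem exists_linearEquiv_apply_eq {v w : Fin 2 → ℂ} (hv : v ≠ 0) (hw : w ≠ 0) :
    ∃ A : (Fin 2 → ℂ) ≃ₗ[ℂ] (Fin 2 → ℂ), A v = w := by
  have h2 : 1 < Module.finrank ℂ (Fin 2 → ℂ) := by simp
  have hcard : Fintype.card (Fin 2) = Module.finrank ℂ (Fin 2 → ℂ) := by simp
  obtain ⟨v', hv'⟩ := exists_linearIndependent_pair_of_one_lt_finrank h2 hv
  obtain ⟨w', hw'⟩ := exists_linearIndependent_pair_of_one_lt_finrank h2 hw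
  set B₁ := basisOfLinearIndependentOfCardEqFinrank hv' hcard with hB₁
  set B₂ := basisOfLinearIndependentOfCardEqFinrank hw' hcard with hB₂
  have h₁ : B₁ 0 = v := by rw [hB₁, coe_basisOfLinearIndependentOfCardEqFinrank]; rfl
  have h₂ : B₂ 0 = w := by rw [hB₂, coe_basisOfLinearIndependentOfCardEqFinrank]; rfl
  refine ⟨B₁.equiv B₂ (Equiv.refl _), ?_⟩
  have key : B₁.equiv B₂ (Equiv.refl _) (B₁ 0) = B₂ (Equiv.refl _ 0) :=
    Module.Basis.equiv_apply ..
  rwa [Equiv.refl_apply, h₁, h₂] at key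

end HelperMoebiusTransitive

/-- **Möbius transformations act transitively on `ℂℙ¹`**: every point `θ` of the Riemann sphere
is the image of the point at infinity `[0 : 1] = linePt 1 0` under the projective transformation
`[v] ↦ [A v]` of some `A ∈ GL₂(ℂ)` (Griffiths–Harris, Ch. 0 §2). [folklore] -/
theorem helper_moebiusTransitive :
    ∀ (θ : Literature.Topology.FourManifolds.ComplexProjectiveSpace 1),
    ∃ A : (Fin 2 → ℂ) ≃ₗ[ℂ] (Fin 2 → ℂ),
      Literature.Geometry.Symplectic.PlusOneSpherePair.projectiveMap A
        (Literature.Topology.FourManifolds.CodimTwoData.linePt 1 0) = θ := by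
  intro θ
  induction θ using ComplexProjectiveSpace.ind with
  | h w =>
    -- the point at infinity is, by definition of the affine chart, the class of this vector
    obtain ⟨A, hA⟩ := HelperMoebiusTransitive.exists_linearEquiv_apply_eq
      (homogenize (n := 1) 1 ((realCoordinates 1).symm (realCoordinates 1 fun _ => (0 : ℂ)))).2
      w.2
    refine ⟨A, ?_⟩
    show PlusOneSpherePair.projectiveMap A
        (mk (homogenize (n := 1) 1 ((realCoordinates 1).symm (realCoordinates 1 fun _ => 0)))) =
      mk w
    rw [PlusOneSpherePair.projectiveMap_mk]
    congr 1
    exact Subtype.ext hA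

end Summit.SmoothPoincare4.SmoothPoincare4.Theorems.GromovRecognitionRelEnd.CrossCapLaurent
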